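import Mathlib.NumberTheory.NumberField.InfinitePlace.Ramification
import Mathlib.NumberTheory.NumberField.InfinitePlace.TotallyRealComplex
import Mathlib.Data.Set.Card
import HarnessLib

/-!
# Infinite places over a totally complex base: a FREE `Gal(E/F)`-set with
# `#S_∞(E) = #S_∞(F) · [E:F]`

Topic `NumberTheory/NumberFields`; namespace `Literature.NumberTheory.NumberFields.EquivariantSUnit`.
THEOREMS ONLY (no definition, no named fact, no `sorry`, no instance); Mathlib only.

For a finite extension `E/F` of number fields with `F` TOTALLY COMPLEX every infinite place of `E` is
complex and unramified over `F` (Mathlib `IsUnramified`: `mult (w|_F) = mult w = 2`); hence, when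
`E/F` is Galois, the decomposition group of every infinite place is trivial
(`InfinitePlace.isUnramified_iff_stabilizer_eq_bot`): `S_∞(E)` is a free `Gal(E/F)`-set with
`#S_∞(F)` orbits and `#S_∞(E) = #S_∞(F)·[E:F]` (Mathlib `IsUnramifiedAtInfinitePlaces.card_infinitePlace`).

* `isUnramifiedAtInfinitePlaces_of_isTotallyComplex`, `InfinitePlace.isUnramified_of_isTotallyComplex`;
* `stabilizer_infinitePlace_eq_bot`, `fixedBy_infinitePlace_eq_empty` (`σ ≠ 1` fixes no infinite
  place), `natCard_fixedBy_infinitePlace` (`= #S_∞(E)` for `σ = 1`, `0` otherwise);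
* `card_infinitePlace_eq_mul` (`#S_∞(E) = #S_∞(F)·[E:F]`), `nrComplexPlaces_eq_mul`.

This is the archimedean bookkeeping of Herbrand's `S`-unit theorem at a totally complex base
(Cassels–Fröhlich VII §8.3: the summand `∏_{v ∈ S_∞} H(G^v, ℤ)` with `G^v = 1`; Neukirch–Schmidt–
Wingberg (8.7.2)/(8.7.4): `r₂(L) = [L:K]·r₂(K)` for totally imaginary `K`); lane «TATE-EPC-TC» of
cell `bsd-eis` (brick B7, the term `−r₂(K₁)·[𝔽_p[C_m]]` of Tate's Euler characteristic).

## References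
* [CasselsFrohlichANT1967] Cassels–Fröhlich, *Algebraic Number Theory*, Ch. VII (Tate) §8.3.
* [NeukirchSchmidtWingberg2008] Neukirch–Schmidt–Wingberg, *Cohomology of Number Fields*, (8.7.2).
* [NeukirchANT1999] J. Neukirch, *Algebraic Number Theory*, Ch. III §3 (infinite primes; complex
  primes are unramified with trivial decomposition group).
-/

namespace Literature.NumberTheory.NumberFields

namespace EquivariantSUnit

open NumberField NumberField.InfinitePlace MulAction

variable (F E : Type*) [Field F] [Field E] [Algebra F E]

/-- **An extension of a totally complex field is unramified at every infinite place** (both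
multiplicities are `2`). [cite: NeukirchANT1999, Ch. III §3 (complex primes are unramified)] -/
theorem isUnramifiedAtInfinitePlaces_of_isTotallyComplex [IsTotallyComplex F] :
    IsUnramifiedAtInfinitePlaces F E :=
  ⟨fun w => InfinitePlace.isUnramified_iff.mpr
    (Or.inr (IsTotallyComplex.isComplex (w.comap (algebraMap F E))))⟩

variable {F E}

/-- Every infinite place of `E` is unramified over a totally complex `F`.
[cite: NeukirchANT1999, Ch. III §3] -/
theorem InfinitePlace.isUnramified_of_isTotallyComplex [IsTotallyComplex F] (w : InfinitePlace E) :
    w.IsUnramified F :=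
  (isUnramifiedAtInfinitePlaces_of_isTotallyComplex F E).isUnramified w

/-- **Trivial decomposition groups at infinity over a totally complex base**: for `E/F` Galois with
`F` totally complex, the stabiliser in `Gal(E/F)` of every infinite place of `E` is trivial.
[cite: NeukirchANT1999, Ch. III §3] [cite: CasselsFrohlichANT1967, Ch. VII §8.3 (`G^v` for `v` complex)] -/
theorem stabilizer_infinitePlace_eq_bot [IsTotallyComplex F] [IsGalois F E] (w : InfinitePlace E) :
    stabilizer (E ≃ₐ[F] E) w = ⊥ :=
  InfinitePlace.isUnramified_iff_stabilizer_eq_bot.1 (InfinitePlace.isUnramified_of_isTotallyComplex w)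

/-- Over a totally complex base, a non-trivial `σ ∈ Gal(E/F)` fixes NO infinite place of `E`
(`S_∞(E)` is a free `Gal(E/F)`-set). [cite: CasselsFrohlichANT1967, Ch. VII §8.3] -/
theorem fixedBy_infinitePlace_eq_empty [IsTotallyComplex F] [IsGalois F E] {σ : E ≃ₐ[F] E}
    (hσ : σ ≠ 1) : fixedBy (InfinitePlace E) σ = ∅ := by
  ext w
  simp only [mem_fixedBy, Set.mem_empty_iff_false, iff_false]
  intro h
  have hmem : σ ∈ stabilizer (E ≃ₐ[F] E) w := mem_stabilizer_iff.2 h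
  rw [stabilizer_infinitePlace_eq_bot, Subgroup.mem_bot] at hmem
  exact hσ hmem

/-- Fixed-point counts of `Gal(E/F)` on `S_∞(E)` over a totally complex base: `#S_∞(E)` for
`σ = 1` and `0` otherwise (the permutation character of a free `G`-set).
[cite: CasselsFrohlichANT1967, Ch. VII §8.3] -/
theorem natCard_fixedBy_infinitePlace [IsTotallyComplex F] [IsGalois F E] [DecidableEq (E ≃ₐ[F] E)]
    (σ : E ≃ₐ[F] E) :
    Nat.card (fixedBy (InfinitePlace E) σ) = if σ = 1 then Nat.card (InfinitePlace E) else 0 := by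
  split_ifs with h
  · subst h
    rw [fixedBy_one_eq_univ, Nat.card_congr (Equiv.Set.univ (InfinitePlace E))]
  · rw [fixedBy_infinitePlace_eq_empty h, Nat.card_coe_set_eq, Set.ncard_empty]

variable (F E) in
/-- **`#S_∞(E) = #S_∞(F) · [E:F]`** for `E/F` Galois over a totally complex `F` (all places split
completely at infinity); Mathlib's `IsUnramifiedAtInfinitePlaces.card_infinitePlace`.
[cite: NeukirchSchmidtWingberg2008, (8.7.2) (r₂(L) = [L:K]·r₂(K) for totally imaginary K)] -/
theorem card_infinitePlace_eq_mul [NumberField F] [NumberField E] [IsTotallyComplex F]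
    [IsGalois F E] :
    Fintype.card (InfinitePlace E) = Fintype.card (InfinitePlace F) * Module.finrank F E := by
  haveI := isUnramifiedAtInfinitePlaces_of_isTotallyComplex F E
  exact IsUnramifiedAtInfinitePlaces.card_infinitePlace F E

variable (F E) in
/-- `r₂(E) = r₂(F) · [E:F]` over a totally complex `F` (`E/F` Galois).
[cite: NeukirchSchmidtWingberg2008, (8.7.2)] -/
theorem nrComplexPlaces_eq_mul [NumberField F] [NumberField E] [IsTotallyComplex F] [IsGalois F E] :
    nrComplexPlaces E = nrComplexPlaces F * Module.finrank F E := by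
  haveI : IsTotallyComplex E := isTotallyComplex_of_algebra (F := F) E
  have hE := card_eq_nrRealPlaces_add_nrComplexPlaces (K := E)
  have hF := card_eq_nrRealPlaces_add_nrComplexPlaces (K := F)
  rw [IsTotallyComplex.nrRealPlaces_eq_zero, zero_add] at hE hF
  rw [← hE, ← hF]
  exact card_infinitePlace_eq_mul F E

variable (F E) in
/-- **`r₂(E) = r₂(F) · [E:F]` over a totally complex `F` for EVERY finite extension `E/F`** (no Galois
hypothesis): both fields are totally complex, so `2 r₂ = [· : ℚ]` (Mathlib `IsTotallyComplex.finrank`) and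
`[E:ℚ] = [F:ℚ]·[E:F]`.  (The exponent bookkeeping `r₂(K_U) = [G_{K,S} : U] · r₂(K)` of Tate's global Euler
characteristic at a totally complex `K`, for an arbitrary open `U`.)
[cite: NeukirchSchmidtWingberg2008, (8.7.2) (r₂ in a tower over a totally imaginary field)] -/
theorem nrComplexPlaces_eq_mul_finrank [NumberField F] [NumberField E] [IsTotallyComplex F] :
    nrComplexPlaces E = nrComplexPlaces F * Module.finrank F E := by
  haveI : IsTotallyComplex E := isTotallyComplex_of_algebra (F := F) E
  haveI : Module.Finite F E := Module.Finite.of_restrictScalars_finite ℚ F E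
  have hE := IsTotallyComplex.finrank (K := E)
  have hF := IsTotallyComplex.finrank (K := F)
  have htower : Module.finrank ℚ E = Module.finrank ℚ F * Module.finrank F E :=
    (Module.finrank_mul_finrank ℚ F E).symm
  rw [hE, hF, mul_assoc] at htower
  exact Nat.eq_of_mul_eq_mul_left (by norm_num) htower

end EquivariantSUnit

end Literature.NumberTheory.NumberFields
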